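import Summits.HubbardSuperconductivity.HubbardSuperconductivity.Theorems.CooperPairDMottWalkCooperPairDMottPairTrialCeilingDecomposition
import Summits.HubbardSuperconductivity.HubbardSuperconductivity.Theorems.CooperPairDMottWalkCooperPairDMottPairTrialCeilingLocality
import Summits.HubbardSuperconductivity.HubbardSuperconductivity.Theorems.CooperPairDMottWalkCooperPairDMottPairTrialCeilingGCDefect
import Summits.HubbardSuperconductivity.HubbardSuperconductivity.Theorems.CooperPairDMottWalkCooperPairDMottPairTrialCeilingWindowReduction
import Summits.HubbardSuperconductivity.HubbardSuperconductivity.Theorems.CooperPairDMottWalkCooperPairDMottPairTrialCeilingPlaquetteData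
import Literature.MathematicalPhysics.QuantumLattice.PairFieldMomentum

/-!
# Route `CooperPairDMottWalk`, crux `CooperPairDMott` (stmt-HubbardSuperconductivity-1177):
# the holon floor — parity bookkeeping of the decoupled plaquettes

Support file for the stub `stub_holonBandFloor` (H, the one-hole threshold from below). The lead's
reduction of H to a relative-bound gap-stability engine needs ONE elementary fact about the
DECOUPLED plaquette Hamiltonian `Σ_c (f_c)_* (h − μ n)` of the breathing torus (`h = hubbardTorus 2 2 1 U`,
block embeddings `f_c : Λ_2 ↪o Λ_L`, `X ↦ 2c + X`): on every state with an ODD number of electrons its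
form lies at least `e₃ − 3μ − (e₄ − 4μ)` above the parent level `(L/2)²(e₄ − 4μ)`, because at least
one plaquette carries an odd number of electrons. This file proves it from sector-wise plaquette data
(`re_oddFloor_intra_of_plaquetteData`):

* `jwEmbed_diagonal`, `card_pre_eq` — second quantisation of a diagonal matrix is diagonal, with the
  occupation pattern pulled back along the embedding;
* `sum_card_inter_orbs_blocks`, `exists_block_odd` — the plaquette occupation numbers add up to the
  total, so an odd total forces an odd plaquette;
* `re_parity_form_ge` — hence `Σ_c (f_c)_* 𝟙_{odd} ≥ 1` on odd-particle-number states;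
* `re_form_ge_of_parity_sectorBounds` — on ONE plaquette, `e‖v‖² + θ Re⟨v, 𝟙_{odd} v⟩ ≤ Re⟨v,(h − μn)v⟩`
  for all `v`, from the sector bounds `h − μn ≥ e` (all sectors) and `≥ e + θ` (odd sectors) —
  block-diagonal decomposition over Lieb's sectors;
* `re_oddFloor_sum_jwEmbed`, `re_oddFloor_intra_of_plaquetteData` — `h − μn − e − θ·𝟙_{odd} ≽ 0` is
  transported along the `(L/2)²` embeddings (positivity is preserved by `*`-homomorphisms) and summed;
  with the plaquette decomposition of the intra-plaquette Hamiltonian this is the odd floor.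

References: E. H. Lieb, PRL 62 (1989) 1201 (sectors); O. Bratteli, D. W. Robinson, *Operator Algebras
and QSM II* §5.2.2 (isotony of local CAR algebras); W.-F. Tsai, S. A. Kivelson, PRB 73 (2006) 214510
(plaquette data). All statements are [folklore]; no definition is introduced.
-/

set_option linter.dupNamespace false

noncomputable section

namespace Summit.HubbardSuperconductivity.HubbardSuperconductivity.Theorems.CooperPairDMottWalk

open Matrix Finset Literature.MathematicalPhysics.QuantumLattice Literature.Probability.LatticeModels
open JWEmbed
open scoped ComplexOrder symmDiff

/-! ### Second quantisation of diagonal matrices -/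

section Diagonal

variable {ι ι' : Type*} [LinearOrder ι] [Fintype ι] [LinearOrder ι'] (e : ι ↪o ι')

/-- The pulled-back pattern counts the occupied orbitals of the range: `|e⁻¹ u'| = |u' ∩ e(ι)|`
(stated for an arbitrary decidability instance, so that it rewrites at concrete orbital types).
[folklore] -/
theorem card_pre_eq [DecidableEq ι'] (u' : Finset ι') : (pre e u').card = (u' ∩ rangeF e).card := by
  rw [← Finset.card_map e.toEmbedding]
  congr 1
  ext j
  simp only [Finset.mem_map, mem_pre, Finset.mem_inter, mem_rangeF, RelEmbedding.coe_toEmbedding]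
  constructor
  · rintro ⟨i, hi, rfl⟩
    exact ⟨hi, i, rfl⟩
  · rintro ⟨hj, i, rfl⟩
    exact ⟨i, hj, rfl⟩

variable [Fintype ι'] [DecidableEq (Finset ι)] [DecidableEq (Finset ι')]

/-- **The second quantisation of a diagonal matrix is diagonal**, with the occupation pattern pulled
back along the embedding: `(e_* diag d)_{u'u'} = d (e⁻¹ u')` (stated for arbitrary decidability
instances, so that it rewrites at concrete orbital types). Bratteli–Robinson II §5.2.2. [folklore] -/
theorem jwEmbed_diagonal (d : Finset ι → ℂ) :
    jwEmbed e (diagonal d) = diagonal fun u' => d (pre e u') := by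
  ext u' v'
  rw [jwEmbed_apply, embedFun_apply]
  by_cases h : u' = v'
  · subst h
    rw [if_pos rfl, symmDiff_self, Finset.bot_eq_empty, transSign_empty, mul_one, diagonal_apply_eq,
      diagonal_apply_eq]
  · rw [diagonal_apply_ne _ h]
    by_cases henv : env e u' = env e v'
    · have hpre : pre e u' ≠ pre e v' := fun h' => h (eq_iff_pre_eq_and_env_eq.2 ⟨h', henv⟩)
      rw [if_pos henv, diagonal_apply_ne _ hpre, zero_mul]
    · rw [if_neg henv]

/-- **The second quantisation is unital** (stated for arbitrary decidability instances, so that it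
rewrites at concrete orbital types). Bratteli–Robinson II §5.2.2. [folklore] -/
theorem jwEmbed_one' : jwEmbed e (1 : Matrix (Finset ι) (Finset ι) ℂ) = 1 := by
  rw [← diagonal_one, jwEmbed_diagonal, diagonal_one]

end Diagonal

/-! ### Parity of the plaquette occupation numbers -/

section Parity

variable {L : ℕ}

/-- **The plaquette occupation numbers add up to the total**: `Σ_c |u ∩ orbs(f_c Λ_2)| = |u|` for the
block family of an even torus (the plaquettes partition the orbitals). [folklore] -/
theorem sum_card_inter_orbs_blocks (hL : Even L) {f : ℕ × ℕ → (FermionTorus 2 2 ↪o FermionTorus 2 L)}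
    (hf : ∀ c ∈ Finset.range (L / 2) ×ˢ Finset.range (L / 2), ∀ X j,
      (ofLex (f c X) j : ℕ) = ![c.1 * 2, c.2 * 2] j + (ofLex X j : ℕ))
    (u : Finset (Orb (FermionTorus 2 L))) :
    ∑ c ∈ Finset.range (L / 2) ×ˢ Finset.range (L / 2),
        (u ∩ orbs ((Finset.univ : Finset (FermionTorus 2 2)).map (f c).toEmbedding)).card = u.card := by
  classical
  have hcover : (Finset.range (L / 2) ×ˢ Finset.range (L / 2)).biUnion
      (fun c => orbs ((Finset.univ : Finset (FermionTorus 2 2)).map (f c).toEmbedding)) = Finset.univ := by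
    rw [← orbs_biUnion, biUnion_range_blockFamily_eq_univ hf hL, orbs_univ]
  symm
  calc u.card = (u ∩ (Finset.range (L / 2) ×ˢ Finset.range (L / 2)).biUnion
        (fun c => orbs ((Finset.univ : Finset (FermionTorus 2 2)).map (f c).toEmbedding))).card := by
          rw [hcover, Finset.inter_univ]
    _ = ∑ c ∈ Finset.range (L / 2) ×ˢ Finset.range (L / 2),
          (u ∩ orbs ((Finset.univ : Finset (FermionTorus 2 2)).map (f c).toEmbedding)).card := by
          rw [Finset.inter_biUnion, Finset.card_biUnion]
          intro c hc c' hc' hne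
          exact Finset.disjoint_left.2 fun i hi hi' =>
            Finset.disjoint_left.1 (disjoint_orbs_range_blockFamily hf c hc c' hc' hne)
              (Finset.mem_inter.1 hi).2 (Finset.mem_inter.1 hi').2

/-- **An odd number of electrons forces an odd plaquette.** [folklore] -/
theorem exists_block_odd (hL : Even L) {f : ℕ × ℕ → (FermionTorus 2 2 ↪o FermionTorus 2 L)}
    (hf : ∀ c ∈ Finset.range (L / 2) ×ˢ Finset.range (L / 2), ∀ X j,
      (ofLex (f c X) j : ℕ) = ![c.1 * 2, c.2 * 2] j + (ofLex X j : ℕ))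
    {u : Finset (Orb (FermionTorus 2 L))} (hu : Odd u.card) :
    ∃ c ∈ Finset.range (L / 2) ×ˢ Finset.range (L / 2),
      Odd (u ∩ orbs ((Finset.univ : Finset (FermionTorus 2 2)).map (f c).toEmbedding)).card := by
  by_contra h
  push Not at h
  have heven : Even (∑ c ∈ Finset.range (L / 2) ×ˢ Finset.range (L / 2),
      (u ∩ orbs ((Finset.univ : Finset (FermionTorus 2 2)).map (f c).toEmbedding)).card) :=
    Finset.even_sum _ fun c hc => Nat.not_odd_iff_even.1 (h c hc)
  rw [sum_card_inter_orbs_blocks hL hf u] at heven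
  exact (Nat.not_even_iff_odd.2 hu) heven

/-- **The summed plaquette parity indicators form a diagonal operator** counting the odd plaquettes:
`Σ_c (f_c)_* 𝟙_{odd} = diag(u ↦ #{c : |u ∩ orbs_c| odd})`. [folklore] -/
theorem sum_jwEmbed_parity_eq_diagonal {f : ℕ × ℕ → (FermionTorus 2 2 ↪o FermionTorus 2 L)} :
    ∑ c ∈ Finset.range (L / 2) ×ˢ Finset.range (L / 2),
        jwEmbed (orbEmb (f c)) (diagonal fun s : Finset (Orb (FermionTorus 2 2)) => if Odd s.card then (1 : ℂ) else 0) =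
      diagonal fun u : Finset (Orb (FermionTorus 2 L)) =>
        ∑ c ∈ Finset.range (L / 2) ×ˢ Finset.range (L / 2),
          if Odd (u ∩ orbs ((Finset.univ : Finset (FermionTorus 2 2)).map (f c).toEmbedding)).card then (1 : ℂ) else 0 := by
  have hterm : ∀ c ∈ Finset.range (L / 2) ×ˢ Finset.range (L / 2),
      jwEmbed (orbEmb (f c)) (diagonal fun s : Finset (Orb (FermionTorus 2 2)) => if Odd s.card then (1 : ℂ) else 0) =
        diagonal fun u : Finset (Orb (FermionTorus 2 L)) =>
          if Odd (u ∩ orbs ((Finset.univ : Finset (FermionTorus 2 2)).map (f c).toEmbedding)).card then (1 : ℂ) else 0 := by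
    intro c _
    rw [jwEmbed_diagonal]
    congr 1
    funext u
    congr 2
    rw [card_pre_eq, rangeF_orbEmb]
  rw [Finset.sum_congr rfl hterm]
  ext u v
  simp only [Matrix.sum_apply, diagonal_apply]
  by_cases huv : u = v
  · simp [huv]
  · simp [huv]

/-- **`Σ_c (f_c)_* 𝟙_{odd} ≥ 1` on odd-particle-number states**: for an `N`-particle vector with `N`
odd, `‖ψ‖² ≤ Re⟨ψ, Σ_c (f_c)_* 𝟙_{odd} ψ⟩`. [folklore] -/
theorem re_parity_form_ge (hL : Even L) {f : ℕ × ℕ → (FermionTorus 2 2 ↪o FermionTorus 2 L)}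
    (hf : ∀ c ∈ Finset.range (L / 2) ×ˢ Finset.range (L / 2), ∀ X j,
      (ofLex (f c X) j : ℕ) = ![c.1 * 2, c.2 * 2] j + (ofLex X j : ℕ))
    {N : ℕ} (hN : Odd N) {ψ : Fock (Orb (FermionTorus 2 L))} (hψ : IsNParticle N ψ) :
    (star ψ ⬝ᵥ ψ).re ≤
      (star ψ ⬝ᵥ ((∑ c ∈ Finset.range (L / 2) ×ˢ Finset.range (L / 2),
        jwEmbed (orbEmb (f c)) (diagonal fun s : Finset (Orb (FermionTorus 2 2)) => if Odd s.card then (1 : ℂ) else 0)) *ᵥ ψ)).re := by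
  classical
  rw [sum_jwEmbed_parity_eq_diagonal, dotProduct, dotProduct, Complex.re_sum, Complex.re_sum]
  refine Finset.sum_le_sum fun u _ => ?_
  rw [mulVec_diagonal, Pi.star_apply]
  by_cases hu : ψ u = 0
  · simp [hu]
  · -- `u` carries `N` electrons, hence an odd plaquette, hence the count is `≥ 1`
    have hcard : u.card = N := by
      by_contra hne
      exact hu (hψ u hne)
    obtain ⟨c₀, hc₀, hodd⟩ := exists_block_odd hL hf (u := u) (hcard ▸ hN)
    rw [Finset.sum_boole]
    set m := (Finset.filter (fun c => Odd (u ∩ orbs ((Finset.univ : Finset (FermionTorus 2 2)).map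
      (f c).toEmbedding)).card) (Finset.range (L / 2) ×ˢ Finset.range (L / 2))).card with hm
    have hm1 : 1 ≤ m := Finset.card_pos.2 ⟨c₀, Finset.mem_filter.2 ⟨hc₀, hodd⟩⟩
    have hsq : 0 ≤ (star (ψ u) * ψ u).re := by
      rw [Complex.star_def, Complex.conj_mul']
      exact_mod_cast sq_nonneg ‖ψ u‖
    have hre : (star (ψ u) * ((m : ℂ) * ψ u)).re = (m : ℝ) * (star (ψ u) * ψ u).re := by
      rw [mul_left_comm, show ((m : ℕ) : ℂ) = ((m : ℝ) : ℂ) from (Complex.ofReal_natCast m).symm,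
        Complex.re_ofReal_mul]
    rw [hre]
    have hm1' : (1 : ℝ) ≤ m := by exact_mod_cast hm1
    nlinarith

end Parity

/-! ### One plaquette: the odd-sector floor as a form inequality -/

section Plaquette

variable {Λ : Type*} [LinearOrder Λ] [Fintype Λ]

/-- Diagonal matrices conserve `(N↑, N↓)` (stated for an arbitrary decidability instance, so that it
applies at concrete orbital types). [folklore] -/
theorem preservesSectors_diagonal' [DecidableEq (Finset (Orb Λ))] (d : Finset (Orb Λ) → ℂ) :
    PreservesSectors (diagonal d) := by
  intro s s' h
  by_cases hss : s = s'
  · subst hss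
    exact ⟨rfl, rfl⟩
  · exact absurd (diagonal_apply_ne d hss) h

/-- A diagonal `0/1` indicator matrix is Hermitian. [folklore] -/
theorem isHermitian_diagonal_indicator {X : Type*} [DecidableEq X] (p : X → Prop) [DecidablePred p] :
    (diagonal fun x : X => if p x then (1 : ℂ) else 0).IsHermitian := by
  refine (isHermitian_diagonal_iff).2 fun x => ?_
  by_cases hx : p x <;> simp [hx]

/-- **The odd-sector floor as a form inequality** (abstract form). Let `A` conserve `(N↑, N↓)` and let
`P` act on each sector `(a, b)` as the parity of `a + b` (the indicator of odd particle number). If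
`Re⟨v, A v⟩ ≥ e‖v‖²` on every sector and `≥ (e + t)‖v‖²` on every odd sector, then
`e‖v‖² + t·Re⟨v, P v⟩ ≤ Re⟨v, A v⟩` for EVERY `v` (block-diagonal decomposition over Lieb's sectors).
Lieb, PRL 62 (1989) 1201. [folklore] -/
theorem re_form_ge_of_parity_sectorBounds {A P : Matrix (Finset (Orb Λ)) (Finset (Orb Λ)) ℂ}
    (hPS : PreservesSectors A) (hPP : PreservesSectors P)
    (hPact : ∀ a b : ℕ, ∀ u : Fock (Orb Λ), IsInSector a b u → P *ᵥ u = (if Odd (a + b) then (1 : ℂ) else 0) • u)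
    {e t : ℝ}
    (h0 : ∀ a b : ℕ, ∀ v : Fock (Orb Λ), IsInSector a b v → e * (star v ⬝ᵥ v).re ≤ (star v ⬝ᵥ (A *ᵥ v)).re)
    (h1 : ∀ a b : ℕ, ¬ Even (a + b) → ∀ v : Fock (Orb Λ), IsInSector a b v →
      (e + t) * (star v ⬝ᵥ v).re ≤ (star v ⬝ᵥ (A *ᵥ v)).re) (v : Fock (Orb Λ)) :
    e * (star v ⬝ᵥ v).re + t * (star v ⬝ᵥ (P *ᵥ v)).re ≤ (star v ⬝ᵥ (A *ᵥ v)).re := by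
  rw [form_eq_sum_sectorProj hPS v, form_eq_sum_sectorProj hPP v, normSq_eq_sum_sectorProj v,
    Complex.re_sum, Complex.re_sum, Complex.re_sum, Finset.mul_sum, Finset.mul_sum, ← Finset.sum_add_distrib]
  refine Finset.sum_le_sum fun ab _ => ?_
  have huS : IsInSector ab.1 ab.2 (sectorProj ab.1 ab.2 v) := isInSector_sectorProj _ _ v
  generalize sectorProj ab.1 ab.2 v = u at huS
  have hnn : 0 ≤ (star u ⬝ᵥ u).re := (Complex.nonneg_iff.1 (dotProduct_star_self_nonneg u)).1
  rw [hPact _ _ u huS, dotProduct_smul, smul_eq_mul]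
  by_cases hodd : Odd (ab.1 + ab.2)
  · rw [if_pos hodd, one_mul]
    have := h1 ab.1 ab.2 (Nat.not_even_iff_odd.2 hodd) u huS
    nlinarith
  · rw [if_neg hodd, zero_mul, Complex.zero_re, mul_zero, add_zero]
    exact h0 ab.1 ab.2 u huS

end Plaquette

/-! ### The breathing torus: the odd floor of the decoupled plaquettes -/

section Torus

variable {L : ℕ}

/-- **The odd floor of the decoupled plaquettes** (even `L`, block family `f_c : X ↦ 2c + X`). Let `A`
be a Hermitian, `(N↑, N↓)`-conserving plaquette operator with `Re⟨v, A v⟩ ≥ e‖v‖²` on every sector and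
`≥ (e + t)‖v‖²` on every odd sector, `t ≥ 0`. Then on every `N`-particle vector of the torus with `N`
odd, `t‖ψ‖² ≤ Re⟨ψ, (Σ_c (f_c)_* A)ψ⟩ − (L/2)²·e·‖ψ‖²`: `A − e − t·𝟙_{odd} ≽ 0` on one plaquette,
`*`-homomorphisms preserve positivity, the constants add up over the `(L/2)²` plaquettes, and at least
one plaquette is odd. [folklore] -/
theorem re_oddFloor_sum_jwEmbed (hL : Even L) {f : ℕ × ℕ → (FermionTorus 2 2 ↪o FermionTorus 2 L)}
    (hf : ∀ c ∈ Finset.range (L / 2) ×ˢ Finset.range (L / 2), ∀ X j,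
      (ofLex (f c X) j : ℕ) = ![c.1 * 2, c.2 * 2] j + (ofLex X j : ℕ))
    {A : Matrix (Finset (Orb (FermionTorus 2 2))) (Finset (Orb (FermionTorus 2 2))) ℂ}
    (hA : A.IsHermitian) (hPS : PreservesSectors A) {e t : ℝ} (ht : 0 ≤ t)
    (h0 : ∀ a b : ℕ, ∀ v : Fock (Orb (FermionTorus 2 2)), IsInSector a b v →
      e * (star v ⬝ᵥ v).re ≤ (star v ⬝ᵥ (A *ᵥ v)).re)
    (h1 : ∀ a b : ℕ, ¬ Even (a + b) → ∀ v : Fock (Orb (FermionTorus 2 2)), IsInSector a b v →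
      (e + t) * (star v ⬝ᵥ v).re ≤ (star v ⬝ᵥ (A *ᵥ v)).re)
    {N : ℕ} (hN : Odd N) {ψ : Fock (Orb (FermionTorus 2 L))} (hψ : IsNParticle N ψ) :
    t * (star ψ ⬝ᵥ ψ).re ≤
      (star ψ ⬝ᵥ ((∑ c ∈ Finset.range (L / 2) ×ˢ Finset.range (L / 2), jwEmbed (orbEmb (f c)) A) *ᵥ ψ)).re
        - (((L / 2) ^ 2 : ℕ) : ℝ) * e * (star ψ ⬝ᵥ ψ).re := by
  -- the parity indicator of ONE plaquette and its action on sectors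
  have hPact : ∀ a b : ℕ, ∀ u : Fock (Orb (FermionTorus 2 2)), IsInSector a b u →
      (diagonal fun s : Finset (Orb (FermionTorus 2 2)) => if Odd s.card then (1 : ℂ) else 0) *ᵥ u =
        (if Odd (a + b) then (1 : ℂ) else 0) • u := by
    intro a b u hu
    funext s
    rw [mulVec_diagonal, Pi.smul_apply, smul_eq_mul]
    by_cases hs : (upPart s).card = a ∧ (downPart s).card = b
    · rw [card_eq_upPart_add_downPart s, hs.1, hs.2]
    · rw [hu s hs, mul_zero, mul_zero]
  have hform := re_form_ge_of_parity_sectorBounds hPS (preservesSectors_diagonal' _) hPact h0 h1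
  -- `X = A − e − t·𝟙_{odd} ≽ 0` on one plaquette
  have hXh : (A - (e : ℂ) • (1 : Matrix (Finset (Orb (FermionTorus 2 2))) (Finset (Orb (FermionTorus 2 2))) ℂ)
      - (t : ℂ) • diagonal (fun s : Finset (Orb (FermionTorus 2 2)) => if Odd s.card then (1 : ℂ) else 0)).IsHermitian :=
    (hA.sub (by rw [IsHermitian, conjTranspose_smul, isHermitian_one.eq, Complex.star_def, Complex.conj_ofReal])).sub
      (by rw [IsHermitian, conjTranspose_smul, (isHermitian_diagonal_indicator _).eq, Complex.star_def,
        Complex.conj_ofReal])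
  have hpsd : (A - (e : ℂ) • (1 : Matrix (Finset (Orb (FermionTorus 2 2))) (Finset (Orb (FermionTorus 2 2))) ℂ)
      - (t : ℂ) • diagonal (fun s : Finset (Orb (FermionTorus 2 2)) => if Odd s.card then (1 : ℂ) else 0)).PosSemidef := by
    refine posSemidef_of_re_nonneg hXh fun v => ?_
    have := hform v
    rw [sub_mulVec, sub_mulVec, smul_mulVec, smul_mulVec, one_mulVec, dotProduct_sub, dotProduct_sub,
      dotProduct_smul, dotProduct_smul, Complex.sub_re, Complex.sub_re, smul_eq_mul, smul_eq_mul,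
      Complex.re_ofReal_mul, Complex.re_ofReal_mul]
    linarith
  -- the embedded sum is positive
  have hsum := Matrix.posSemidef_sum (Finset.range (L / 2) ×ˢ Finset.range (L / 2))
    fun c _ => posSemidef_jwEmbed (orbEmb (f c)) hpsd
  have hpos := (Complex.nonneg_iff.1 (hsum.dotProduct_mulVec_nonneg ψ)).1
  -- expand the embedded sum termwise and collect
  simp only [jwEmbed_sub', jwEmbed_smul', jwEmbed_one', Finset.sum_sub_distrib, Finset.sum_const,
    card_blocks_half, ← Finset.smul_sum] at hpos
  rw [← Nat.cast_smul_eq_nsmul ℂ, smul_smul, sub_mulVec, sub_mulVec, smul_mulVec, smul_mulVec, one_mulVec,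
    dotProduct_sub, dotProduct_sub, dotProduct_smul, dotProduct_smul, smul_eq_mul, smul_eq_mul, Complex.sub_re,
    Complex.sub_re, Complex.re_ofReal_mul,
    show ((((L / 2) ^ 2 : ℕ) : ℂ) * (e : ℂ)) = (((((L / 2) ^ 2 : ℕ) : ℝ) * e : ℝ) : ℂ) by push_cast; ring,
    Complex.re_ofReal_mul] at hpos
  have hpar := re_parity_form_ge hL hf hN hψ
  nlinarith [mul_le_mul_of_nonneg_left hpar ht]

/-- **The odd floor of the decoupled plaquettes at `μ = U/2`, from plaquette data.** If the plaquette
`h = hubbardTorus 2 2 1 U` satisfies `Re⟨v, (h − (U/2)N)v⟩ ≥ (e₄ − 2U)‖v‖²` on every sector and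
`≥ (e₃ − 3U/2)‖v‖²` on every odd sector, with `e₃ − 3U/2 ≥ e₄ − 2U`, then every `N`-particle vector of
the torus with `N` odd satisfies
`(e₃ − 3U/2 − (e₄ − 2U))‖ψ‖² ≤ Re⟨ψ, (H_intra − (U/2)N)ψ⟩ − (L/2)²(e₄ − 2U)‖ψ‖²`: at least one
plaquette is odd and pays the holon price. [folklore] -/
theorem re_oddFloor_intra_of_plaquetteData [NeZero L] (hL : Even L) (U : ℝ)
    (h0 : ∀ a b : ℕ, ∀ v : Fock (Orb (FermionTorus 2 2)), IsInSector a b v →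
      ((hubbardTorus 2 2 1 U).minEnergyOn (szSector 4 0) - 2 * U) * (star v ⬝ᵥ v).re ≤
        (star v ⬝ᵥ ((hubbardTorus 2 2 1 U - ((U / 2 : ℝ) : ℂ) • totalNumber) *ᵥ v)).re)
    (h1 : ∀ a b : ℕ, ¬ Even (a + b) → ∀ v : Fock (Orb (FermionTorus 2 2)), IsInSector a b v →
      ((hubbardTorus 2 2 1 U).minEnergyOn (szSector 3 (1 / 2)) - 3 * (U / 2)) * (star v ⬝ᵥ v).re ≤
        (star v ⬝ᵥ ((hubbardTorus 2 2 1 U - ((U / 2 : ℝ) : ℂ) • totalNumber) *ᵥ v)).re)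
    (hθ : (hubbardTorus 2 2 1 U).minEnergyOn (szSector 4 0) - 2 * U ≤
        (hubbardTorus 2 2 1 U).minEnergyOn (szSector 3 (1 / 2)) - 3 * (U / 2))
    {N : ℕ} (hN : Odd N) {ψ : Fock (Orb (FermionTorus 2 L))} (hψ : IsNParticle N ψ) :
    ((hubbardTorus 2 2 1 U).minEnergyOn (szSector 3 (1 / 2)) - 3 * (U / 2)
          - ((hubbardTorus 2 2 1 U).minEnergyOn (szSector 4 0) - 2 * U)) * (star ψ ⬝ᵥ ψ).re ≤
      (star ψ ⬝ᵥ ((hamiltonian (fermionTorusGraph 2 L \ (⊤ : SimpleGraph (Fin 2 → ℕ)).comap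
          (fun (x : FermionTorus 2 L) (i : Fin 2) => (ofLex x i : ℕ) / 2)) 1 U
          - ((U / 2 : ℝ) : ℂ) • totalNumber) *ᵥ ψ)).re
        - (((L / 2) ^ 2 : ℕ) : ℝ) * ((hubbardTorus 2 2 1 U).minEnergyOn (szSector 4 0) - 2 * U) * (star ψ ⬝ᵥ ψ).re := by
  obtain ⟨f, hf⟩ := FermionTorus.exists_blockFamily L 2 (by have := NeZero.ne L; obtain ⟨k, hk⟩ := hL; omega)
  have hA : (hubbardTorus 2 2 1 U - ((U / 2 : ℝ) : ℂ) • totalNumber).IsHermitian :=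
    (LiebThm1.hamiltonian_isHermitian _ 1 U).sub (by
      rw [IsHermitian, conjTranspose_smul, totalNumber_isHermitian.eq, Complex.star_def, Complex.conj_ofReal])
  have hPS : PreservesSectors (hubbardTorus 2 2 1 U - ((U / 2 : ℝ) : ℂ) • totalNumber) := by
    have hN : PreservesSectors (totalNumber : Matrix (Finset (Orb (FermionTorus 2 2))) _ ℂ) := by
      rw [LiebThm1.totalNumber_eq_diagonal]; exact PreservesSectors.diagonal _
    rw [sub_eq_add_neg, ← neg_smul]
    exact (LiebThm1.preservesSectors_hamiltonian plaquetteGraph 1 U).add (hN.smul _)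
  have key := re_oddFloor_sum_jwEmbed hL hf hA hPS (sub_nonneg.2 hθ) h0
    (fun a b hab v hv => by have := h1 a b hab v hv; linarith) hN hψ
  -- identify the block sum with the intra-plaquette Hamiltonian minus `(U/2) N`
  have hdec := hamiltonian_intra_eq_sum_jwEmbed hL U hf
  rw [plaquetteHamiltonian_eq_hubbardTorus] at hdec
  have hsumA : ∑ c ∈ Finset.range (L / 2) ×ˢ Finset.range (L / 2),
      jwEmbed (orbEmb (f c)) (hubbardTorus 2 2 1 U - ((U / 2 : ℝ) : ℂ) • totalNumber) =
      hamiltonian (fermionTorusGraph 2 L \ (⊤ : SimpleGraph (Fin 2 → ℕ)).comap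
          (fun (x : FermionTorus 2 L) (i : Fin 2) => (ofLex x i : ℕ) / 2)) 1 U
        - ((U / 2 : ℝ) : ℂ) • totalNumber := by
    simp only [jwEmbed_sub', jwEmbed_smul', Finset.sum_sub_distrib, ← Finset.smul_sum]
    rw [← hdec, sum_jwEmbed_totalNumber_eq hL hf]
  rw [hsumA] at key
  linarith

end Torus

/-! ### Registered form -/

/-- **Registered sub-goal `holonBandFloor_oddFloor`** (closed form, as registered on the crux item):
the odd floor of the decoupled plaquettes at `μ = U/2` from plaquette sector data. [folklore] -/
theorem holonBandFloor_oddFloor : ∀ {L : ℕ} [NeZero L], Even L → ∀ (U : ℝ), (∀ a b : ℕ, ∀ v : Fock (Orb (FermionTorus 2 2)), IsInSector a b v → ((hubbardTorus 2 2 1 U).minEnergyOn (szSector 4 0) - 2 * U) * (star v ⬝ᵥ v).re ≤ (star v ⬝ᵥ ((hubbardTorus 2 2 1 U - ((U / 2 : ℝ) : ℂ) • totalNumber) *ᵥ v)).re) → (∀ a b : ℕ, ¬ Even (a + b) → ∀ v : Fock (Orb (FermionTorus 2 2)), IsInSector a b v → ((hubbardTorus 2 2 1 U).minEnergyOn (szSector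 3 (1 / 2)) - 3 * (U / 2)) * (star v ⬝ᵥ v).re ≤ (star v ⬝ᵥ ((hubbardTorus 2 2 1 U - ((U / 2 : ℝ) : ℂ) • totalNumber) *ᵥ v)).re) → (hubbardTorus 2 2 1 U).minEnergyOn (szSector 4 0) - 2 * U ≤ (hubbardTorus 2 2 1 U).minEnergyOn (szSector 3 (1 / 2)) - 3 * (U / 2) → ∀ {N : ℕ}, Odd N → ∀ {ψ : Fock (Orb (FermionTorus 2 L))}, IsNParticle N ψ → ((hubbardTorus 2 2 1 U).minEnergyOn (szSector 3 (1 / 2)) - 3 * (U / 2) - ((hubbardTorus 2 2 1 U).minEnergyOn (szSector 4 0) - 2 * U)) * (star ψ ⬝ᵥ ψ).re ≤ (star ψ ⬝ᵥ ((hamiltonian (fermionTorusGraph 2 L \ (⊤ : SimpleGraph (Fin 2 → ℕ)).comap (fun (x : FermionTorus 2 L) (i : Fin 2) => (ofLex x i : ℕ) / 2)) 1 U - ((U / 2 : ℝ) : ℂ) • totalNumber) *ᵥ ψ)).re - (((L / 2) ^ 2 : ℕ) : ℝ) * ((hubbardTorus 2 2 1 U).minEnergyOn (szSector 4 0) - 2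 * U) * (star ψ ⬝ᵥ ψ).re :=
  fun hL U h0 h1 hθ _ hN _ hψ => re_oddFloor_intra_of_plaquetteData hL U h0 h1 hθ hN hψ

end Summit.HubbardSuperconductivity.HubbardSuperconductivity.Theorems.CooperPairDMottWalk

end
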